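import Mathlib
import Summits.NavierStokesRegularity.NavierStokesRegularity.Theorems.EulerZoomLiouvillePowerGaugeEulerLiouvilleBandClockMember
import Summits.NavierStokesRegularity.NavierStokesRegularity.Theorems.EulerZoomLiouvillePowerGaugeEulerLiouvilleNeedleLogisticLaw
import Summits.NavierStokesRegularity.NavierStokesRegularity.Theorems.EulerZoomLiouvillePowerGaugeEulerLiouvilleWeakBernoulliTransportTools
import HarnessLib

/-!
# «VIRIAL FORM» of the radial acceleration, and the VIRIAL-DEFICIT kill
# (crux `EulerZoomLiouville.PowerGaugeEulerLiouville` = stmt-NavierStokesRegularity-19832, THE ONE STATEMENT `stub_selfSimilarC2Needle`;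
# binder `HasFastVorticalChannel`, alternative 3 — LEAD ns-typeII-p2 g13 KEY «VIRIAL FORM» 21:42:50Z to width seat ns-ezl-w1 g6)

Route `EulerZoomLiouville` (NavierStokesRegularity), crux E.  With `W y = γy + V y` (`selfSimilarTransport γ 0 V`), `ℛ(y) = ⟪y, W y⟫`
(radial rate), `ℋ = ½|W|² + P′ + ½γ(γ−1)|y|²` (`selfSimilarBernoulli γ 0 V P′`) and the forward RADIAL ACCELERATION of the similarity
flow `a(y) = ‖W y‖² + γ⟪y, W y⟫ + ⟪y, DV(y)(W y)⟫ = Dℛ(y)[W y]` (LEAD's `…BandClockTools`):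

* (V1) **`VirialForm.radialAcceleration_eq`** — CLASS-FREE pointwise identity for every classical profile
  (`IsSelfSimilarEulerProfile γ 0 V P′`, CIV (3.3) `DV(y)W = −(1−γ)V − ∇P′`):
  `a(y) = 2ℋ(y) + 2γ(1−γ)‖y‖² − (1−2γ)⟪y, W y⟫ − (2P′(y) + ⟪y, ∇P′(y)⟫)`;
  the last bracket is the VIRIAL (Pohozaev) density `2P′ + y·∇P′ = |y|⁻¹ ∂_r(r² … )`-type quantity of the pressure.
* (V2) **`Loc.selfSimilar_ae_eq_zero_of_virialDeficitC2_profile`** — MEMBER LEVEL (crux hypotheses verbatim, `0 < ρ ≤ ½`, exact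
  self-similarity about the origin, `V ∈ C²`): if for ONE pair `c₁, μ > 0`, every classical pressure `P′` and every level `h` there is a
  radius beyond which every VORTICAL `ℋ_{P′}`-high point of the INFLOW HALF-BAND `−c₁‖y‖² ≤ ⟪y, W y⟫ ≤ 0` has the VIRIAL DEFICIT
  `2P′(y) + ⟪y, ∇P′(y)⟫ ≤ 2h + (2γ(1−γ) − 2c₁² − μ)‖y‖²`, the member is trivial — a ten-line corollary of the LEAD's
  `Loc.selfSimilar_ae_eq_zero_of_inflowBandDeficitC2_profile` (`…BandClockMember`): by (V1), `ℋ > h`, `ℛ ≤ 0` and `γ < ½` the virial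
  deficit gives the inflow half-band deficit `a(y) ≥ (2c₁² + μ)‖y‖²`.
* **`Past.selfSimilar_ae_eq_zero_of_virialDeficitC2_profile_past`** — the same for members exactly self-similar about `(T, x₀)` for
  `τ < T₁` only (`…_inflowBandDeficitC2_profile_past`).

Reading for THE ONE STATEMENT (its negation): for all `c₁, μ > 0` the needle has, beyond every radius, vortical Bernoulli-high NEAR-CIRCULAR
inflow points that are VIRIAL-SUPPORTED: `2P′ + y·∇P′ > 2h + (2γ(1−γ) − 2c₁² − μ)‖y‖²` — the T2/pressure face in binder shape.

WHAT THIS IS NOT: not NS, not E — a pointwise identity and a by-name corollary on the model lattice, `--supports` stmt-19832; DENT 0 on the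
registered stubs; 19832 OPEN; NS regularity is NOT proved; no summit statement is proved by this seat.
[folklore; cf. ConstantinIgnatovaVicol2026Putative §3.1.1 (3.3), §3.4 (3.19), §3.4.3 (3.30)]
-/

noncomputable section

-- flat `Theorems/<Route><Decl>…` files of one crux share the namespace of the crux (tree convention: `Summit.<S>.<S>.…`)
set_option linter.dupNamespace false

open Set Filter Topology Metric Function MeasureTheory
open scoped RealInnerProductSpace NNReal ENNReal

namespace Summit.NavierStokesRegularity.NavierStokesRegularity.Theorems.PowerGaugeEulerLiouville

open Literature.Analysis Literature.Analysis.FluidPDE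

namespace VirialForm

variable {γ : ℝ} {V : EuclideanSpace ℝ (Fin 3) → EuclideanSpace ℝ (Fin 3)} {P : EuclideanSpace ℝ (Fin 3) → ℝ}

/-- **(V1) THE VIRIAL FORM OF THE RADIAL ACCELERATION** (class-free, every classical profile `IsSelfSimilarEulerProfile γ 0 V P`):
`‖W y‖² + γ⟪y, W y⟫ + ⟪y, DV(y)(W y)⟫ = 2ℋ(y) + 2γ(1−γ)‖y‖² − (1−2γ)⟪y, W y⟫ − (2P(y) + ⟪y, ∇P(y)⟫)` — the profile equation (3.3)
`DV(y)(W y) = −(1−γ)V(y) − ∇P(y)` tested against `y` (`Logistic.inner_fderiv_velocity_transport`), plus the algebra of `ℋ` and `|W|²`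
about the origin (`WeakBernoulli.bernoulli_zero_apply`, `WeakBernoulli.norm_transport_zero_sq`).
[cite: ConstantinIgnatovaVicol2026Putative, §3.1.1 eq. (3.3)] -/
theorem radialAcceleration_eq (hprof : IsSelfSimilarEulerProfile γ 0 V P) (y : EuclideanSpace ℝ (Fin 3)) :
    ‖selfSimilarTransport γ 0 V y‖ ^ 2 + γ * ⟪y, selfSimilarTransport γ 0 V y⟫ +
        ⟪y, fderiv ℝ V y (selfSimilarTransport γ 0 V y)⟫ =
      2 * selfSimilarBernoulli γ 0 V P y + 2 * γ * (1 - γ) * ‖y‖ ^ 2 -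
        (1 - 2 * γ) * ⟪y, selfSimilarTransport γ 0 V y⟫ - (2 * P y + ⟪y, gradient P y⟫) := by
  rw [real_inner_comm (fderiv ℝ V y (selfSimilarTransport γ 0 V y)) y,
    Logistic.inner_fderiv_velocity_transport hprof y y, WeakBernoulli.norm_transport_zero_sq,
    WeakBernoulli.inner_transport_zero_right, WeakBernoulli.bernoulli_zero_apply, real_inner_self_eq_norm_sq,
    real_inner_comm (gradient P y) y, real_inner_comm (V y) y]
  ring

/-- **(V1′) FROM A VIRIAL DEFICIT TO THE INFLOW HALF-BAND DEFICIT** (class-free, pointwise): for a classical profile with `γ ≤ ½`, at a point with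
`ℋ(y) > h`, `⟪y, W y⟫ ≤ 0` and `2P(y) + ⟪y, ∇P(y)⟫ ≤ 2h + (2γ(1−γ) − 2c₁² − μ)‖y‖²`, the radial acceleration satisfies
`a(y) ≥ (2c₁² + μ)‖y‖²`. [folklore] -/
theorem bandDeficit_of_virialDeficit (hprof : IsSelfSimilarEulerProfile γ 0 V P) (hγ : γ ≤ 1 / 2) {c₁ μ h : ℝ}
    {y : EuclideanSpace ℝ (Fin 3)} (hh : h < selfSimilarBernoulli γ 0 V P y)
    (hR : ⟪y, selfSimilarTransport γ 0 V y⟫ ≤ 0)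
    (hvir : 2 * P y + ⟪y, gradient P y⟫ ≤ 2 * h + (2 * γ * (1 - γ) - 2 * c₁ ^ 2 - μ) * ‖y‖ ^ 2) :
    (2 * c₁ ^ 2 + μ) * ‖y‖ ^ 2 ≤ ‖selfSimilarTransport γ 0 V y‖ ^ 2 + γ * ⟪y, selfSimilarTransport γ 0 V y⟫ +
      ⟪y, fderiv ℝ V y (selfSimilarTransport γ 0 V y)⟫ := by
  rw [radialAcceleration_eq hprof y]
  have h1 : 0 ≤ -((1 - 2 * γ) * ⟪y, selfSimilarTransport γ 0 V y⟫) := by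
    rw [neg_mul_eq_neg_mul]
    exact mul_nonneg_of_nonpos_of_nonpos (by linarith) hR
  linarith

end VirialForm

/-- **(V2) EXACTLY SELF-SIMILAR MEMBERS WHOSE `C²` PROFILE HAS A VIRIAL DEFICIT ON THE FAR VORTICAL BERNOULLI-HIGH INFLOW HALF-BAND ARE TRIVIAL.**
Crux hypotheses verbatim (`0 < ρ ≤ ½`, `γ = 1/(2+ρ)`), exact self-similarity about the origin, `V ∈ C²`; for ONE pair `c₁ > 0`, `μ > 0`, every
classical pressure `P′` of the profile and every level `h` there is `R₀` such that every point `y` with `‖y‖ ≥ R₀`, `ℋ_{P′}(y) > h`,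
`curl V y ≠ 0`, `−c₁‖y‖² ≤ ⟪y, W y⟫ ≤ 0` has `2P′(y) + ⟪y, ∇P′(y)⟫ ≤ 2h + (2γ(1−γ) − 2c₁² − μ)‖y‖²`.  Then `u = 0` a.e. on the slab.
Proof: `VirialForm.bandDeficit_of_virialDeficit` turns the hypothesis into the inflow half-band deficit of the LEAD's
`Loc.selfSimilar_ae_eq_zero_of_inflowBandDeficitC2_profile`. [folklore; cf. ConstantinIgnatovaVicol2026Putative §3.4–§3.5] -/
theorem Loc.selfSimilar_ae_eq_zero_of_virialDeficitC2_profile {ρ : ℝ} (hρ : 0 < ρ) (hρ1 : ρ ≤ 1 / 2)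
    {u : ℝ → EuclideanSpace ℝ (Fin 3) → EuclideanSpace ℝ (Fin 3)} {p : ℝ → EuclideanSpace ℝ (Fin 3) → ℝ}
    {H : ℝ → EuclideanSpace ℝ (Fin 3) → EuclideanSpace ℝ (Fin 3) →L[ℝ] EuclideanSpace ℝ (Fin 3)} {c : ℝ≥0}
    (hsw : IsSuitableWeakSolutionOn (slab (EuclideanSpace ℝ (Fin 3)) (Iio 0) isOpen_Iio) 0 0 u p)
    (hH : HasWeakSpatialGradientOn (slab (EuclideanSpace ℝ (Fin 3)) (Iio 0) isOpen_Iio) u H)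
    (hgauge : ∀ a : ℝ, 0 < a →
      ENNReal.ofReal (a ^ (2 * ρ)) * cknA a (0 : ℝ × EuclideanSpace ℝ (Fin 3)) u +
          ENNReal.ofReal (a ^ ρ) * cknE a (0 : ℝ × EuclideanSpace ℝ (Fin 3)) H +
        ENNReal.ofReal (a ^ (2 * ρ)) * cknD a (0 : ℝ × EuclideanSpace ℝ (Fin 3)) p ≤ (c : ℝ≥0∞))
    {V : EuclideanSpace ℝ (Fin 3) → EuclideanSpace ℝ (Fin 3)} {P : EuclideanSpace ℝ (Fin 3) → ℝ}
    (hu : ∀ τ : ℝ, τ < 0 → u τ = selfSimilarCollapse (1 / (2 + ρ)) 0 V τ)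
    (hp : ∀ τ : ℝ, τ < 0 → p τ = selfSimilarCollapsePressure (1 / (2 + ρ)) 0 P τ)
    (hV : ContDiff ℝ 2 V) {c₁ μ : ℝ} (hc₁ : 0 < c₁) (hμ : 0 < μ)
    (hVir : ∀ P' : EuclideanSpace ℝ (Fin 3) → ℝ, IsSelfSimilarEulerProfile (1 / (2 + ρ)) 0 V P' →
      ∀ h : ℝ, ∃ R₀ : ℝ, ∀ y : EuclideanSpace ℝ (Fin 3), R₀ ≤ ‖y‖ →
        h < selfSimilarBernoulli (1 / (2 + ρ)) 0 V P' y → curl V y ≠ 0 →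
          -(c₁ * ‖y‖ ^ 2) ≤ ⟪y, selfSimilarTransport (1 / (2 + ρ)) 0 V y⟫ →
          ⟪y, selfSimilarTransport (1 / (2 + ρ)) 0 V y⟫ ≤ 0 →
          2 * P' y + ⟪y, gradient P' y⟫ ≤
            2 * h + (2 * (1 / (2 + ρ)) * (1 - 1 / (2 + ρ)) - 2 * c₁ ^ 2 - μ) * ‖y‖ ^ 2) :
    uncurry u =ᵐ[volume.restrict (Iio (0 : ℝ) ×ˢ (univ : Set (EuclideanSpace ℝ (Fin 3))))] 0 := by
  have hγ : 1 / (2 + ρ) ≤ 1 / 2 := one_div_le_one_div_of_le (by norm_num) (by linarith)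
  refine Loc.selfSimilar_ae_eq_zero_of_inflowBandDeficitC2_profile hρ hρ1 hsw hH hgauge hu hp hV hc₁ hμ
    fun P' hprof h => ?_
  obtain ⟨R₀, hR₀⟩ := hVir P' hprof h
  exact ⟨R₀, fun y hy hh hcurl hlo hhi =>
    VirialForm.bandDeficit_of_virialDeficit hprof hγ hh hhi (hR₀ y hy hh hcurl hlo hhi)⟩

namespace Past

variable {ρ T T₁ : ℝ}
  {u : ℝ → EuclideanSpace ℝ (Fin 3) → EuclideanSpace ℝ (Fin 3)} {p : ℝ → EuclideanSpace ℝ (Fin 3) → ℝ}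
  {H : ℝ → EuclideanSpace ℝ (Fin 3) → EuclideanSpace ℝ (Fin 3) →L[ℝ] EuclideanSpace ℝ (Fin 3)} {c : ℝ≥0}
  {V : EuclideanSpace ℝ (Fin 3) → EuclideanSpace ℝ (Fin 3)} {P : EuclideanSpace ℝ (Fin 3) → ℝ}

/-- **PAST-EXACT MEMBER WHOSE `C²` PROFILE HAS A VIRIAL DEFICIT ON THE FAR VORTICAL BERNOULLI-HIGH INFLOW HALF-BAND IS TRIVIAL** (crux hypotheses
verbatim, `0 < ρ ≤ ½`; exact self-similarity about `(T, x₀)` for `τ < T₁`, `T₁ ≤ 0`, `T₁ ≤ T`; `V ∈ C²`; the virial-deficit hypothesis of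
`Loc.selfSimilar_ae_eq_zero_of_virialDeficitC2_profile`).  By-name corollary of the LEAD's `Past.selfSimilar_ae_eq_zero_of_inflowBandDeficitC2_profile_past`.
[folklore; cf. ConstantinIgnatovaVicol2026Putative §3.4–§3.5] -/
theorem selfSimilar_ae_eq_zero_of_virialDeficitC2_profile_past (hρ : 0 < ρ) (hρh : ρ ≤ 1 / 2) (hT₁ : T₁ ≤ 0)
    (hTT₁ : T₁ ≤ T) (x₀ : EuclideanSpace ℝ (Fin 3))
    (hsw : IsSuitableWeakSolutionOn (slab (EuclideanSpace ℝ (Fin 3)) (Iio 0) isOpen_Iio) 0 0 u p)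
    (hH : HasWeakSpatialGradientOn (slab (EuclideanSpace ℝ (Fin 3)) (Iio 0) isOpen_Iio) u H)
    (hgauge : ∀ a : ℝ, 0 < a →
      ENNReal.ofReal (a ^ (2 * ρ)) * cknA a (0 : ℝ × EuclideanSpace ℝ (Fin 3)) u +
          ENNReal.ofReal (a ^ ρ) * cknE a (0 : ℝ × EuclideanSpace ℝ (Fin 3)) H +
        ENNReal.ofReal (a ^ (2 * ρ)) * cknD a (0 : ℝ × EuclideanSpace ℝ (Fin 3)) p ≤ (c : ℝ≥0∞))
    (hu : ∀ τ : ℝ, τ < T₁ → u τ = fun x => selfSimilarCollapse (1 / (2 + ρ)) T V τ (x - x₀))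
    (hp : ∀ τ : ℝ, τ < T₁ → p τ = fun x => selfSimilarCollapsePressure (1 / (2 + ρ)) T P τ (x - x₀))
    (hV : ContDiff ℝ 2 V) {c₁ μ : ℝ} (hc₁ : 0 < c₁) (hμ : 0 < μ)
    (hVir : ∀ P' : EuclideanSpace ℝ (Fin 3) → ℝ, IsSelfSimilarEulerProfile (1 / (2 + ρ)) 0 V P' →
      ∀ h : ℝ, ∃ R₀ : ℝ, ∀ y : EuclideanSpace ℝ (Fin 3), R₀ ≤ ‖y‖ →
        h < selfSimilarBernoulli (1 / (2 + ρ)) 0 V P' y → curl V y ≠ 0 →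
          -(c₁ * ‖y‖ ^ 2) ≤ ⟪y, selfSimilarTransport (1 / (2 + ρ)) 0 V y⟫ →
          ⟪y, selfSimilarTransport (1 / (2 + ρ)) 0 V y⟫ ≤ 0 →
          2 * P' y + ⟪y, gradient P' y⟫ ≤
            2 * h + (2 * (1 / (2 + ρ)) * (1 - 1 / (2 + ρ)) - 2 * c₁ ^ 2 - μ) * ‖y‖ ^ 2) :
    uncurry u =ᵐ[volume.restrict (Iio (0 : ℝ) ×ˢ (univ : Set (EuclideanSpace ℝ (Fin 3))))] 0 := by
  have hγ : 1 / (2 + ρ) ≤ 1 / 2 := one_div_le_one_div_of_le (by norm_num) (by linarith)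
  refine selfSimilar_ae_eq_zero_of_inflowBandDeficitC2_profile_past hρ hρh hT₁ hTT₁ x₀ hsw hH hgauge hu hp hV hc₁ hμ
    fun P' hprof h => ?_
  obtain ⟨R₀, hR₀⟩ := hVir P' hprof h
  exact ⟨R₀, fun y hy hh hcurl hlo hhi =>
    VirialForm.bandDeficit_of_virialDeficit hprof hγ hh hhi (hR₀ y hy hh hcurl hlo hhi)⟩

end Past

end Summit.NavierStokesRegularity.NavierStokesRegularity.Theorems.PowerGaugeEulerLiouville

end
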